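import Literature.NumberTheory.LFunctions.ZetaMulHarmonicMean
import Literature.NumberTheory.LFunctions.ZetaMulMeanValue
import Mathlib.NumberTheory.Chebyshev
import Mathlib.NumberTheory.ArithmeticFunction.VonMangoldt
import HarnessLib

/-!
# Mertens' estimate for a real character: `∑_{n ≤ x} χ(n)Λ(n)/n = O(1)` and
# `∑_{p ≤ x} χ(p) log p/p = O(1)`

Topic `Literature/NumberTheory/LFunctions`. Everything in this file is PROVED (theorems only).

For a non-principal quadratic character `χ` mod `q` we prove the character analogue of Mertens'
first theorem by the classical elementary argument (Landau; Montgomery–Vaughan §4.3,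
Apostol Thm. 6.?): from `log n = ∑_{d ∣ n} Λ(d)` and complete multiplicativity,
`∑_{n ≤ x} χ(n) log n/n = ∑_{d ≤ x} χ(d)Λ(d)/d · ∑_{m ≤ x/d} χ(m)/m`
(`sum_re_mul_log_div_eq`), the inner sums being `L(1, χ) + O(q d/x)` while the left side is
`−L'(1, χ) + O(q log x/x)` (the tree's `CharacterHarmonicTails.lean`); with Chebyshev's bound
`ψ(x) ≪ x` (Mathlib's `Chebyshev.psi_le_const_mul_self`) and `L(1, χ) > 0` this gives

* `exists_abs_sum_re_mul_vonMangoldt_div_le` — `|∑_{n ≤ x} χ(n)Λ(n)/n| ≤ K` for all `x`;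
* `sum_not_prime_vonMangoldt_div_le` — the prime powers `p^k`, `k ≥ 2`, contribute `O(1)`:
  `∑_{n ≤ x, n not prime} Λ(n)/n ≤ C₀` (Abel summation of Mathlib's `ψ(x) − θ(x) ≤ 2√x log x`);
* `exists_abs_sum_primesLE_re_mul_log_div_le` — hence `|∑_{p ≤ x} χ(p) log p/p| ≤ K'` for all `x`.

The last bound is the prime-number-theoretic input of the convergence of the Euler product of
`L(1, χ)` at `s = 1` (`EulerProductAtOne.lean`), used in the discharge of Granville–Mollin's
Proposition 2 (`Literature.Barriers.Parity.GranvilleMollin2000_prop2`).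

## References

* H. L. Montgomery, R. C. Vaughan, *Multiplicative Number Theory I*, CUP 2007, §4.3
  (Mertens-type estimates for `L(1, χ)`; proof of Dirichlet's theorem) [MontgomeryVaughan2007].
* E. Landau, *Handbuch der Lehre von der Verteilung der Primzahlen* (1909), §§108–110 [folklore].
-/

noncomputable section

open Complex Filter Topology Finset
open scoped ArithmeticFunction.vonMangoldt Chebyshev
open Literature.NumberTheory.LFunctions.DirichletAbel

namespace Literature.NumberTheory.LFunctions.CharacterMertens

variable {q : ℕ} [NeZero q] (χ : DirichletCharacter ℂ q)

/-! ### Real values of a quadratic character -/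

omit [NeZero q] in
/-- Complete multiplicativity of the real values: `χ(mn) = χ(m)χ(n)` for quadratic `χ`. [folklore] -/
theorem re_apply_mul (hq : χ ^ 2 = 1) (m n : ℕ) :
    (χ ((m * n : ℕ) : ZMod q)).re = (χ (m : ZMod q)).re * (χ (n : ZMod q)).re := by
  rw [Nat.cast_mul, map_mul, SiegelZero.apply_eq_ofReal_re χ hq (m : ZMod q),
    SiegelZero.apply_eq_ofReal_re χ hq (n : ZMod q), ← Complex.ofReal_mul, Complex.ofReal_re,
    Complex.ofReal_re, Complex.ofReal_re]

/-! ### `∑ χ(n) log n/n` as a double sum -/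

omit [NeZero q] in
/-- **`∑_{n ≤ x} χ(n) log n/n = ∑_{d ≤ x} (χ(d)Λ(d)/d) ∑_{m ≤ x/d} χ(m)/m`** (`log n = ∑_{d∣n} Λ(d)`,
`n = dm`, `χ(n)/n = (χ(d)/d)(χ(m)/m)`). [cite: MontgomeryVaughan2007, §4.3] -/
theorem sum_re_mul_log_div_eq (hq : χ ^ 2 = 1) (x : ℕ) :
    ∑ n ∈ Icc 1 x, (χ (n : ZMod q)).re * Real.log n / n =
      ∑ d ∈ Icc 1 x, (χ (d : ZMod q)).re * Λ d / d *
        ∑ m ∈ Icc 1 (x / d), (χ (m : ZMod q)).re / m := by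
  have hI : ∀ K : ℕ, Icc 1 K = Ioc 0 K := fun K => by
    ext n; simp only [Finset.mem_Icc, Finset.mem_Ioc]; omega
  rw [hI]
  have h1 : ∀ n ∈ Ioc 0 x, (χ (n : ZMod q)).re * Real.log n / n =
      ∑ d ∈ n.divisors, (χ (n : ZMod q)).re * Λ d / n := by
    intro n _
    rw [← ArithmeticFunction.vonMangoldt_sum, Finset.mul_sum, Finset.sum_div]
  rw [Finset.sum_congr rfl h1,
    Finset.sum_comm' (t' := Ioc 0 x) (s' := fun d => (Ioc 0 x).filter (d ∣ ·))]
  · refine Finset.sum_congr rfl fun d hd => ?_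
    have hd0 : 0 < d := (Finset.mem_Ioc.mp hd).1
    have hd0' : (d : ℝ) ≠ 0 := by exact_mod_cast hd0.ne'
    rw [ZetaMulHarmonic.filter_dvd_Ioc_eq_image hd0, Finset.sum_image (fun a _ b _ h => Nat.eq_of_mul_eq_mul_left hd0 h),
      Finset.mul_sum, hI]
    refine Finset.sum_congr rfl fun m hm => ?_
    have hm0 : (m : ℝ) ≠ 0 := by exact_mod_cast (Finset.mem_Ioc.mp hm).1.ne'
    rw [re_apply_mul χ hq]
    push_cast
    field_simp
  · intro n d
    simp only [Finset.mem_Ioc, Nat.mem_divisors, Finset.mem_filter]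
    constructor
    · rintro ⟨⟨hn0, hnN⟩, hdn, hn⟩
      have hd0 : 0 < d := Nat.pos_of_ne_zero fun h => hn (Nat.eq_zero_of_zero_dvd (h ▸ hdn))
      exact ⟨⟨⟨hn0, hnN⟩, hdn⟩, hd0, (Nat.le_of_dvd hn0 hdn).trans hnN⟩
    · rintro ⟨⟨⟨hn0, hnN⟩, hdn⟩, _, _⟩
      exact ⟨⟨hn0, hnN⟩, hdn, Nat.pos_iff_ne_zero.mp hn0⟩

/-! ### The two inputs from `CharacterHarmonicTails.lean` (trivial window bound `2q`) -/

/-- `|∑_{m ≤ y} χ(m)/m − L(1, χ)| ≤ 2q/(y+1)` (real form). [cite: MontgomeryVaughan2007, §4.3 Thm. 4.8] -/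
theorem abs_sum_re_div_sub_le (hχ : χ ≠ 1) (hq : χ ^ 2 = 1) (y : ℕ) :
    |∑ m ∈ Icc 1 y, (χ (m : ZMod q)).re / m - (χ.LFunction 1).re| ≤ 2 * q / ((y : ℝ) + 1) := by
  have h := CharacterTails.norm_sum_Icc_div_sub_LFunction_one_le χ hχ (N := y)
    (fun n => SiegelZero.norm_sum_Ioc_apply_le χ hχ y n)
  have hre : ∑ m ∈ Icc 1 y, (χ (m : ZMod q)).re / m - (χ.LFunction 1).re =
      (∑ n ∈ Icc 1 y, χ (n : ZMod q) / n - χ.LFunction 1).re := by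
    rw [Complex.sub_re, Complex.re_sum]
    congr 1
    refine Finset.sum_congr rfl fun n _ => ?_
    rw [SiegelZero.apply_eq_ofReal_re χ hq, ← Complex.ofReal_natCast, ← Complex.ofReal_div,
      Complex.ofReal_re, Complex.ofReal_re]
  rw [hre]
  exact (Complex.abs_re_le_norm _).trans h

/-- `|∑_{n ≤ x} χ(n) log n/n| ≤ |L'(1, χ)| + 2q` for all `x`. [cite: MontgomeryVaughan2007, §4.3 Thm. 4.8] -/
theorem abs_sum_re_mul_log_div_le (hχ : χ ≠ 1) (hq : χ ^ 2 = 1) (x : ℕ) :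
    |∑ n ∈ Icc 1 x, (χ (n : ZMod q)).re * Real.log n / n| ≤ ‖deriv χ.LFunction 1‖ + 2 * q := by
  have hq0 : (0 : ℝ) ≤ q := Nat.cast_nonneg q
  rcases lt_or_ge x 2 with hx | hx
  · -- `x ≤ 1`: the sum vanishes (`log 1 = 0`)
    interval_cases x
    · simp; positivity
    · simp; positivity
  have h := CharacterTails.norm_sum_Icc_mul_log_div_add_deriv_le χ hχ hx
    (fun n => SiegelZero.norm_sum_Ioc_apply_le χ hχ x n)
  have hre : ∑ n ∈ Icc 1 x, (χ (n : ZMod q)).re * Real.log n / n =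
      (∑ n ∈ Icc 1 x, χ (n : ZMod q) * ((Real.log n / n : ℝ) : ℂ) + deriv χ.LFunction 1).re -
        (deriv χ.LFunction 1).re := by
    rw [Complex.add_re, add_sub_cancel_right, Complex.re_sum]
    refine Finset.sum_congr rfl fun n _ => ?_
    rw [SiegelZero.apply_eq_ofReal_re χ hq, ← Complex.ofReal_mul, Complex.ofReal_re, Complex.ofReal_re]
    ring
  rw [hre]
  have h1 := (Complex.abs_re_le_norm _).trans h
  have h2 : (2 : ℝ) * q * (Real.log (x + 1 : ℕ) / (x + 1 : ℕ)) ≤ 2 * q := by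
    have hx0 : (0 : ℝ) < (x + 1 : ℕ) := by positivity
    have : Real.log (x + 1 : ℕ) / (x + 1 : ℕ) ≤ 1 := by
      rw [div_le_one hx0]
      have := Real.log_le_sub_one_of_pos hx0
      linarith
    calc (2 : ℝ) * q * (Real.log (x + 1 : ℕ) / (x + 1 : ℕ)) ≤ 2 * q * 1 :=
          mul_le_mul_of_nonneg_left this (by positivity)
      _ = 2 * q := mul_one _
  have h3 := Complex.abs_re_le_norm (deriv χ.LFunction 1)
  calc |(∑ n ∈ Icc 1 x, χ (n : ZMod q) * ((Real.log n / n : ℝ) : ℂ) + deriv χ.LFunction 1).re -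
        (deriv χ.LFunction 1).re|
      ≤ |(∑ n ∈ Icc 1 x, χ (n : ZMod q) * ((Real.log n / n : ℝ) : ℂ) + deriv χ.LFunction 1).re| +
        |(deriv χ.LFunction 1).re| := abs_sub _ _
    _ ≤ 2 * q * (Real.log (x + 1 : ℕ) / (x + 1 : ℕ)) + ‖deriv χ.LFunction 1‖ := add_le_add h1 h3
    _ ≤ ‖deriv χ.LFunction 1‖ + 2 * q := by linarith

/-! ### Mertens' estimate for `χΛ` -/

/-- **`∑_{n ≤ x} χ(n)Λ(n)/n = O(1)`** for a non-principal quadratic character: there is `K`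
(depending on `χ`) with `|∑_{n ≤ x} χ(n)Λ(n)/n| ≤ K` for all `x`. Proof:
`L(1,χ) ∑_{d≤x} χ(d)Λ(d)/d = ∑_{n≤x} χ(n) log n/n − ∑_{d≤x} (χ(d)Λ(d)/d) r_d` with
`|r_d| ≤ 2q/(⌊x/d⌋+1) ≤ 2q d/x`, so the last sum is `≤ 2q ψ(x)/x ≤ 2q(log 4 + 4)`.
[cite: MontgomeryVaughan2007, §4.3] -/
theorem exists_abs_sum_re_mul_vonMangoldt_div_le (hχ : χ ≠ 1) (hq : χ ^ 2 = 1) :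
    ∃ K : ℝ, ∀ x : ℕ, |∑ n ∈ Icc 1 x, (χ (n : ZMod q)).re * Λ n / n| ≤ K := by
  have hL1pos : 0 < (χ.LFunction 1).re := by
    have h := ZetaMul.LOne_pos χ hχ hq
    rwa [ZetaMul.LOne] at h
  set L₁ : ℝ := (χ.LFunction 1).re with hL₁
  set C : ℝ := ‖deriv χ.LFunction 1‖ + 2 * q + 2 * q * (Real.log 4 + 4) with hC
  refine ⟨C / L₁, fun x => ?_⟩
  rw [le_div_iff₀ hL1pos]
  have hq0 : (0 : ℝ) ≤ q := Nat.cast_nonneg q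
  rcases Nat.eq_zero_or_pos x with hx | hx
  · subst hx; simp [hC]; positivity
  have hx0 : (0 : ℝ) < x := by exact_mod_cast hx
  -- the identity
  have hid := sum_re_mul_log_div_eq χ hq x
  set A : ℝ := ∑ n ∈ Icc 1 x, (χ (n : ZMod q)).re * Λ n / n with hA
  -- `∑_d (χΛ/d)(inner − L₁)` is small
  have hinner : ∀ d ∈ Icc 1 x,
      |(χ (d : ZMod q)).re * Λ d / d * (∑ m ∈ Icc 1 (x / d), (χ (m : ZMod q)).re / m - L₁)| ≤
        2 * q * (Λ d / x) := by
    intro d hd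
    obtain ⟨hd1, hdx⟩ := Finset.mem_Icc.mp hd
    have hd0 : (0 : ℝ) < d := by exact_mod_cast hd1
    have h1 := abs_sum_re_div_sub_le χ hχ hq (x / d)
    -- `1/(⌊x/d⌋ + 1) ≤ d/x`
    have h2 : 2 * q / (((x / d : ℕ) : ℝ) + 1) ≤ 2 * q * (d / x) := by
      rw [div_eq_mul_inv]
      refine mul_le_mul_of_nonneg_left ?_ (by positivity)
      rw [inv_le_iff_one_le_mul₀ (by positivity), div_mul_eq_mul_div, le_div_iff₀ hx0, one_mul]
      have := Nat.lt_div_mul_add (a := x) hd1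
      have h' : (x : ℝ) < ((x / d : ℕ) : ℝ) * d + d := by exact_mod_cast this
      nlinarith
    have hΛ : 0 ≤ Λ d := ArithmeticFunction.vonMangoldt_nonneg
    rw [abs_mul, abs_div, abs_mul, abs_of_nonneg hΛ, abs_of_pos hd0]
    calc |(χ (d : ZMod q)).re| * Λ d / d * |∑ m ∈ Icc 1 (x / d), (χ (m : ZMod q)).re / m - L₁|
        ≤ 1 * Λ d / d * (2 * q * (d / x)) := by
          refine mul_le_mul ?_ (h1.trans h2) (abs_nonneg _) (by positivity)
          exact div_le_div_of_nonneg_right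
            (mul_le_mul_of_nonneg_right ((Complex.abs_re_le_norm _).trans (DirichletCharacter.norm_le_one χ _)) hΛ) hd0.le
      _ = 2 * q * (Λ d / x) := by field_simp
  -- Chebyshev
  have hψ : ∑ d ∈ Icc 1 x, Λ d ≤ (Real.log 4 + 4) * x := by
    have h := Chebyshev.psi_le_const_mul_self (x := (x : ℝ)) hx0.le
    rw [Chebyshev.psi_eq_sum_Icc, Nat.floor_natCast] at h
    refine le_trans ?_ h
    refine Finset.sum_le_sum_of_subset_of_nonneg (fun n hn => ?_) fun n _ _ =>
      ArithmeticFunction.vonMangoldt_nonneg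
    rw [Finset.mem_Icc] at hn ⊢; omega
  -- assemble: `L₁ A = ∑ χ log n/n − ∑ (χΛ/d)(inner − L₁)`
  have hdecomp : L₁ * A = ∑ n ∈ Icc 1 x, (χ (n : ZMod q)).re * Real.log n / n -
      ∑ d ∈ Icc 1 x, (χ (d : ZMod q)).re * Λ d / d *
        (∑ m ∈ Icc 1 (x / d), (χ (m : ZMod q)).re / m - L₁) := by
    rw [hid, hA, Finset.mul_sum, ← Finset.sum_sub_distrib]
    refine Finset.sum_congr rfl fun d _ => ?_
    ring
  have hbound : |L₁ * A| ≤ C := by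
    rw [hdecomp]
    refine (abs_sub _ _).trans ?_
    have hE : |∑ d ∈ Icc 1 x, (χ (d : ZMod q)).re * Λ d / d *
        (∑ m ∈ Icc 1 (x / d), (χ (m : ZMod q)).re / m - L₁)| ≤ 2 * q * (Real.log 4 + 4) := by
      refine (Finset.abs_sum_le_sum_abs _ _).trans ((Finset.sum_le_sum hinner).trans ?_)
      rw [← Finset.mul_sum, ← Finset.sum_div]
      calc 2 * q * ((∑ d ∈ Icc 1 x, Λ d) / x) ≤ 2 * q * ((Real.log 4 + 4) * x / x) := by
            gcongr
        _ = 2 * q * (Real.log 4 + 4) := by field_simp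
    have hM := abs_sum_re_mul_log_div_le χ hχ hq x
    rw [hC]; linarith
  rw [abs_mul, abs_of_pos hL1pos, mul_comm] at hbound
  exact hbound

/-! ### The prime powers `p^k`, `k ≥ 2`, contribute `O(1)` -/

/-- `ψ(n) − θ(n) = ∑_{m ≤ n, m not prime} Λ(m)` as a `Finset.Icc` sum (Mathlib). [folklore] -/
theorem psi_sub_theta_natCast (n : ℕ) :
    ψ (n : ℝ) - θ (n : ℝ) = ∑ m ∈ (Icc 1 n).filter (fun m => ¬ m.Prime), Λ m := by
  rw [Chebyshev.psi_sub_theta_eq_sum_not_prime, Nat.floor_natCast]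
  have hI : Icc 1 n = Ioc 0 n := by ext m; simp only [Finset.mem_Icc, Finset.mem_Ioc]; omega
  rw [hI]

/-- `0 ≤ ψ(n) − θ(n) ≤ 8 n^{3/4}`: from Mathlib's `ψ(x) − θ(x) ≤ 2√x log x` and `log x ≤ 4x^{1/4}`.
[folklore] -/
theorem psi_sub_theta_le_rpow (n : ℕ) : ψ (n : ℝ) - θ (n : ℝ) ≤ 8 * (n : ℝ) ^ (3 / 4 : ℝ) := by
  rcases Nat.eq_zero_or_pos n with rfl | hn
  · rw [Nat.cast_zero, Real.zero_rpow (by norm_num), mul_zero]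
    have h1 : ψ (0 : ℝ) = 0 := Chebyshev.psi_eq_zero_of_le_one (by norm_num)
    have h2 := Chebyshev.theta_nonneg (0 : ℝ)
    linarith
  have hn1 : (1 : ℝ) ≤ n := by exact_mod_cast hn
  have hn0 : (0 : ℝ) ≤ n := by linarith
  have h := Chebyshev.psi_sub_theta_le hn1
  have hlog : Real.log n ≤ (n : ℝ) ^ (1 / 4 : ℝ) / (1 / 4) := Real.log_le_rpow_div hn0 (by norm_num)
  have hsqrt : Real.sqrt n = (n : ℝ) ^ (1 / 2 : ℝ) := Real.sqrt_eq_rpow _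
  calc ψ (n : ℝ) - θ (n : ℝ) ≤ 2 * Real.sqrt n * Real.log n := h
    _ ≤ 2 * Real.sqrt n * ((n : ℝ) ^ (1 / 4 : ℝ) / (1 / 4)) :=
        mul_le_mul_of_nonneg_left hlog (by positivity)
    _ = 8 * ((n : ℝ) ^ (1 / 2 : ℝ) * (n : ℝ) ^ (1 / 4 : ℝ)) := by rw [hsqrt]; ring
    _ = 8 * (n : ℝ) ^ (3 / 4 : ℝ) := by rw [← Real.rpow_add' hn0 (by norm_num)]; norm_num

/-- **The non-prime prime powers contribute `O(1)`**: there is an absolute `C₀` with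
`∑_{m ≤ n, m not prime} Λ(m)/m ≤ C₀` for all `n` (Abel summation of `ψ − θ ≤ 8 x^{3/4}` against `1/m`:
the sum is `≤ (ψ−θ)(n)/(n+1) + ∑_m (ψ−θ)(m)/(m(m+1)) ≤ 8 + 8 ∑_m m^{−5/4}`). [folklore] -/
theorem sum_not_prime_vonMangoldt_div_le :
    ∃ C₀ : ℝ, ∀ n : ℕ, ∑ m ∈ (Icc 1 n).filter (fun m => ¬ m.Prime), Λ m / m ≤ C₀ := by
  have hsum : Summable (fun m : ℕ => (m : ℝ) ^ (-(5 / 4) : ℝ)) :=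
    Real.summable_nat_rpow.mpr (by norm_num)
  refine ⟨8 + 8 * ∑' m : ℕ, (m : ℝ) ^ (-(5 / 4) : ℝ), fun n => ?_⟩
  -- write the sum as `∑_{m ∈ Ioc 0 n} c(m) g(m)` with `c = Λ·[¬prime]`, `g(m) = 1/m`, and apply Abel
  set c : ℕ → ℝ := fun m => if m.Prime then 0 else Λ m with hc
  have hD : ∀ k : ℕ, ∑ j ∈ Ioc 0 k, c j = ψ (k : ℝ) - θ (k : ℝ) := by
    intro k
    rw [psi_sub_theta_natCast, Finset.sum_filter]
    have hI : Icc 1 k = Ioc 0 k := by ext m; simp only [Finset.mem_Icc, Finset.mem_Ioc]; omega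
    rw [hI]
    refine Finset.sum_congr rfl fun m _ => ?_
    simp only [hc]
    split_ifs <;> simp_all
  have hlhs : ∑ m ∈ (Icc 1 n).filter (fun m => ¬ m.Prime), Λ m / m =
      ∑ m ∈ Ioc 0 n, c m * (1 / (m : ℝ)) := by
    have hI : Icc 1 n = Ioc 0 n := by ext m; simp only [Finset.mem_Icc, Finset.mem_Ioc]; omega
    rw [hI, Finset.sum_filter]
    refine Finset.sum_congr rfl fun m _ => ?_
    by_cases hm : m.Prime <;> simp [hc, hm, div_eq_mul_inv]
  rw [hlhs, ZetaMul.sum_Ioc_mul_eq_abel c (fun m => 1 / (m : ℝ)) 0 n]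
  simp only [hD]
  -- boundary term
  have hD0 : ∀ k : ℕ, 0 ≤ ψ (k : ℝ) - θ (k : ℝ) := fun k => sub_nonneg.mpr (Chebyshev.theta_le_psi _)
  have hbdry : (ψ (n : ℝ) - θ (n : ℝ)) * (1 / ((n + 1 : ℕ) : ℝ)) ≤ 8 := by
    have h1 := psi_sub_theta_le_rpow n
    have hn1 : (0 : ℝ) < ((n + 1 : ℕ) : ℝ) := by positivity
    have h34 : (n : ℝ) ^ (3 / 4 : ℝ) ≤ ((n + 1 : ℕ) : ℝ) := by
      have hn0 : (0 : ℝ) ≤ n := Nat.cast_nonneg n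
      calc (n : ℝ) ^ (3 / 4 : ℝ) ≤ (n : ℝ) ^ (3 / 4 : ℝ) * 1 := (mul_one _).symm.le
        _ ≤ ((n : ℝ) + 1) ^ (3 / 4 : ℝ) * ((n : ℝ) + 1) ^ (1 / 4 : ℝ) :=
            mul_le_mul (Real.rpow_le_rpow hn0 (by linarith) (by norm_num))
              (Real.one_le_rpow (by linarith) (by norm_num)) zero_le_one (by positivity)
        _ = (n : ℝ) + 1 := by rw [← Real.rpow_add (by linarith)]; norm_num
        _ = ((n + 1 : ℕ) : ℝ) := by push_cast; ring
    rw [mul_one_div, div_le_iff₀ hn1]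
    linarith
  -- the Abel sum
  have hterm : ∀ k ∈ Ioc 0 n, (ψ (k : ℝ) - θ (k : ℝ)) * (1 / (k : ℝ) - 1 / ((k + 1 : ℕ) : ℝ)) ≤
      8 * (k : ℝ) ^ (-(5 / 4) : ℝ) := by
    intro k hk
    have hk0 : (0 : ℝ) < k := by exact_mod_cast (Finset.mem_Ioc.mp hk).1
    have hdiff : 1 / (k : ℝ) - 1 / ((k + 1 : ℕ) : ℝ) = 1 / ((k : ℝ) * (k + 1)) := by
      push_cast; field_simp; ring
    have hdiff_le : 1 / ((k : ℝ) * (k + 1)) ≤ (k : ℝ) ^ (-2 : ℝ) := by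
      rw [Real.rpow_neg hk0.le, show (2 : ℝ) = (2 : ℕ) by norm_num, Real.rpow_natCast, one_div]
      exact inv_anti₀ (by positivity) (by nlinarith)
    rw [hdiff]
    calc (ψ (k : ℝ) - θ (k : ℝ)) * (1 / ((k : ℝ) * (k + 1)))
        ≤ (8 * (k : ℝ) ^ (3 / 4 : ℝ)) * (k : ℝ) ^ (-2 : ℝ) :=
          mul_le_mul (psi_sub_theta_le_rpow k) hdiff_le (by positivity) (by positivity)
      _ = 8 * (k : ℝ) ^ (-(5 / 4) : ℝ) := by
          rw [mul_assoc, ← Real.rpow_add hk0]; norm_num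
  have hA : ∑ k ∈ Ioc 0 n, (ψ (k : ℝ) - θ (k : ℝ)) * (1 / (k : ℝ) - 1 / ((k + 1 : ℕ) : ℝ)) ≤
      8 * ∑' m : ℕ, (m : ℝ) ^ (-(5 / 4) : ℝ) := by
    refine (Finset.sum_le_sum hterm).trans ?_
    rw [← Finset.mul_sum]
    refine mul_le_mul_of_nonneg_left ?_ (by norm_num)
    exact hsum.sum_le_tsum (Ioc 0 n) fun m _ => Real.rpow_nonneg (Nat.cast_nonneg m) _
  push_cast at hbdry hA ⊢
  linarith

/-! ### Mertens' estimate over primes -/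

omit [NeZero q] in
/-- Splitting `∑_{n ≤ x} χ(n)Λ(n)/n` into primes and non-primes. [folklore] -/
theorem sum_re_mul_vonMangoldt_div_eq_add (x : ℕ) :
    ∑ n ∈ Icc 1 x, (χ (n : ZMod q)).re * Λ n / n =
      ∑ p ∈ Nat.primesLE x, (χ (p : ZMod q)).re * Real.log p / p +
        ∑ n ∈ (Icc 1 x).filter (fun n => ¬ n.Prime), (χ (n : ZMod q)).re * Λ n / n := by
  rw [← Finset.sum_filter_add_sum_filter_not (Icc 1 x) Nat.Prime]
  congr 1
  have hset : (Icc 1 x).filter Nat.Prime = Nat.primesLE x := by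
    ext p
    simp only [Finset.mem_filter, Finset.mem_Icc, Nat.mem_primesLE]
    constructor
    · rintro ⟨⟨-, hpx⟩, hp⟩; exact ⟨hpx, hp⟩
    · rintro ⟨hpx, hp⟩; exact ⟨⟨hp.one_lt.le, hpx⟩, hp⟩
  rw [hset]
  refine Finset.sum_congr rfl fun p hp => ?_
  rw [ArithmeticFunction.vonMangoldt_apply_prime (Nat.prime_of_mem_primesLE hp)]

/-- **Mertens' estimate for `χ` over primes**: for a non-principal quadratic character `χ` there
is `K'` with `|∑_{p ≤ x} χ(p) log p/p| ≤ K'` for all `x`. [cite: MontgomeryVaughan2007, §4.3] -/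
theorem exists_abs_sum_primesLE_re_mul_log_div_le (hχ : χ ≠ 1) (hq : χ ^ 2 = 1) :
    ∃ K' : ℝ, ∀ x : ℕ, |∑ p ∈ Nat.primesLE x, (χ (p : ZMod q)).re * Real.log p / p| ≤ K' := by
  obtain ⟨K, hK⟩ := exists_abs_sum_re_mul_vonMangoldt_div_le χ hχ hq
  obtain ⟨C₀, hC₀⟩ := sum_not_prime_vonMangoldt_div_le
  refine ⟨K + C₀, fun x => ?_⟩
  have h1 := hK x
  rw [sum_re_mul_vonMangoldt_div_eq_add] at h1
  have h2 : |∑ n ∈ (Icc 1 x).filter (fun n => ¬ n.Prime), (χ (n : ZMod q)).re * Λ n / n| ≤ C₀ := by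
    refine (Finset.abs_sum_le_sum_abs _ _).trans (le_trans (Finset.sum_le_sum fun n hn => ?_) (hC₀ x))
    have hn0 : (0 : ℝ) < n := by
      exact_mod_cast (Finset.mem_Icc.mp (Finset.mem_filter.mp hn).1).1
    rw [abs_div, abs_mul, abs_of_nonneg ArithmeticFunction.vonMangoldt_nonneg, abs_of_pos hn0]
    refine div_le_div_of_nonneg_right ?_ hn0.le
    calc |(χ (n : ZMod q)).re| * Λ n ≤ 1 * Λ n :=
          mul_le_mul_of_nonneg_right ((Complex.abs_re_le_norm _).trans (DirichletCharacter.norm_le_one χ _)) ArithmeticFunction.vonMangoldt_nonneg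
      _ = Λ n := one_mul _
  have := abs_add_le (∑ p ∈ Nat.primesLE x, (χ (p : ZMod q)).re * Real.log p / p +
      ∑ n ∈ (Icc 1 x).filter (fun n => ¬ n.Prime), (χ (n : ZMod q)).re * Λ n / n)
    (-(∑ n ∈ (Icc 1 x).filter (fun n => ¬ n.Prime), (χ (n : ZMod q)).re * Λ n / n))
  rw [abs_neg, add_neg_cancel_right] at this
  linarith

end Literature.NumberTheory.LFunctions.CharacterMertens
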